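import Literature.Geometry.Symplectic.HirzebruchSignatureAlmostComplexFour
import Literature.Geometry.Symplectic.ComplexifiedTangentSplitting
import HarnessLib

/-!
# `c₁² = 2χ + 3σ` for closed almost complex `4`-manifolds: reduction to the signature theorem
# and the top Chern number theorem

Topic `Literature/Geometry/Symplectic`.  The named fact
`hirzebruch_firstChernClass_sq_eq_almostComplex_four` (`HirzebruchSignatureAlmostComplexFour.lean`;
McDuff–Salamon 2017, Rem. 4.1.10 eq. (4.1.7)) is printed (loc. cit., Ex. 4.4.3 (v); Hirzebruch
1966, Thm. 8.2.2 with Thm. 4.5.1 and Thm. 4.10.1) as the combination of three results: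

1. `p₁(N) = c₁(TN, J)² - 2 c₂(TN, J)` (Hirzebruch Thm. 4.5.1) — PROVED in the tree:
   `AlmostComplexStructure.tangentPontryaginClass_one_eq` (`ComplexifiedTangentSplitting.lean`, on
   the Pontryagin classes of `Complexification.lean` and the conjugate bundle of
   `ConjugateBundle.lean`);
2. the signature theorem in dimension four, `⟨p₁(N), [N]⟩ = 3 σ(N)` (Hirzebruch Thm. 8.2.2,
   `k = 1`) — NOT in the tree (its printed proofs need the bordism invariance of Pontryagin numbers
   and `Ω₄ ⊗ ℚ = ℚ[ℂP²]`, cf. the unproved fact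
   `Literature.Topology.FourManifolds.isOrientedBordant_of_signature_eq`);
3. the top Chern number theorem `⟨c₂(TN, J), [N]⟩ = χ(N)` (Hirzebruch Thm. 4.10.1; Milnor–Stasheff
   Cor. 11.12) — NOT in the tree.

This file proves the reduction: `three_mul_signature_eq_of_signatureTheorem` turns (2), through (1),
into McDuff–Salamon's (4.4.3) `3σ = ⟨c₁², [N]⟩ - 2⟨c₂, [N]⟩` for every orientation, and
`hirzebruch_firstChernClass_sq_eq_almostComplex_four_of_signatureTheorem_of_topChernNumber` derives
the named fact from (2) and (3) stated as explicit hypotheses (in the tree's vocabulary: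
`tangentPontryaginClass`, `kroneckerPairing`, `HomologicalOrientation.signature`, `relEuler`).
No new named facts; nothing is assumed at top level.

## References

* D. McDuff, D. Salamon, *Introduction to Symplectic Topology*, 3rd ed., OUP (2017), Rem. 4.1.10
  eq. (4.1.7), Ex. 4.4.3 (v) eq. (4.4.3). [McDuffSalamon2017]
* F. Hirzebruch, *Topological Methods in Algebraic Geometry*, 3rd ed., Springer (1966),
  Thm. 4.5.1 (p. 66), Thm. 4.10.1 (p. 71), Thm. 8.2.2 (p. 86). [Hirzebruch1966]
* J. Milnor, J. Stasheff, *Characteristic Classes*, Ann. of Math. Stud. 76 (1974), Cor. 11.12,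
  Cor. 15.5, §19. [MilnorStasheffAMS76]
-/

noncomputable section

open scoped Manifold ContDiff
open Literature.AlgebraicTopology.SingularHomology Literature.AlgebraicTopology.CharacteristicClasses

namespace Literature.Geometry.Symplectic

/-- **McDuff–Salamon's (4.4.3), `3σ = ⟨c₁² - 2c₂, [N]⟩`, from the signature theorem** (hypothesis
`hsig`: `⟨p₁(N), [N]_μ⟩ = 3 σ(N, μ)` for every closed connected smooth `4`-manifold and orientation —
Hirzebruch Thm. 8.2.2 for `k = 1`, "`τ(M⁴) = ⅓ p₁[M⁴]`"; not proved in the tree): by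
`p₁(N) = c₁(TN, J)² - 2 c₂(TN, J)` (`tangentPontryaginClass_one_eq`, Hirzebruch Thm. 4.5.1),
`⟨p₁, [N]⟩ = 3σ` reads `3σ = ⟨c₁ ⌣ c₁, [N]⟩ - 2 ⟨c₂, [N]⟩` — for every orientation `μ`.
[cite: McDuffSalamon2017, Ex. 4.4.3 (v) eq. (4.4.3)] [cite: Hirzebruch1966, Thm. 4.5.1 and Thm. 8.2.2] -/
theorem three_mul_signature_eq_of_signatureTheorem
    (hsig : ∀ (N : Type) [TopologicalSpace N] [T2Space N] [SecondCountableTopology N]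
      [CompactSpace N] [ConnectedSpace N] [ChartedSpace (EuclideanSpace ℝ (Fin 4)) N]
      [IsManifold (𝓡 4) ∞ N] (μ : HomologicalOrientation ℤ N 4),
      kroneckerPairing ℤ ℤ N 4 (degCast ℤ (by norm_num : 4 * 1 = 4) (tangentPontryaginClass (𝓡 4) N 1))
        μ.fundamentalClass = 3 * μ.signature)
    (N : Type) [TopologicalSpace N] [T2Space N] [SecondCountableTopology N]
    [CompactSpace N] [ConnectedSpace N] [ChartedSpace (EuclideanSpace ℝ (Fin 4)) N]
    [IsManifold (𝓡 4) ∞ N] (J : AlmostComplexStructure (𝓡 4) ∞ N) (μ : HomologicalOrientation ℤ N 4) :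
    3 * μ.signature =
      cupPairing μ two_add_two_eq_four J.firstChernClass J.firstChernClass -
        2 * kroneckerPairing ℤ ℤ N 4 (degCast ℤ (by norm_num : 2 * 2 = 4) (J.chernClass 2)) μ.fundamentalClass := by
  rw [← hsig N μ, J.tangentPontryaginClass_one_eq, map_sub, LinearMap.sub_apply, cupPairing_apply,
    LinearMap.map_smul_of_tower, LinearMap.smul_apply, smul_eq_mul]

/-- **Hirzebruch's `c₁² = 2χ + 3σ` for closed almost complex `4`-manifolds from the two classical
theorems it is printed from** — the signature theorem in dimension four (`⟨p₁, [N]⟩ = 3σ`,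
Hirzebruch Thm. 8.2.2) and the top Chern number theorem (`⟨c₂(TN, J), [N]⟩ = χ(N)`, Thm. 4.10.1):
with `p₁ = c₁² - 2c₂` (Thm. 4.5.1, proved in `ComplexifiedTangentSplitting`),
`⟨c₁², [N]⟩ = ⟨p₁, [N]⟩ + 2⟨c₂, [N]⟩ = 3σ + 2χ` (McDuff–Salamon Rem. 4.1.10 eq. (4.1.7)).
[cite: McDuffSalamon2017, Rem. 4.1.10 eq. (4.1.7)] [cite: Hirzebruch1966, Thm. 4.5.1, Thm. 4.10.1, Thm. 8.2.2] -/
theorem hirzebruch_firstChernClass_sq_eq_almostComplex_four_of_signatureTheorem_of_topChernNumber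
    (hsig : ∀ (N : Type) [TopologicalSpace N] [T2Space N] [SecondCountableTopology N]
      [CompactSpace N] [ConnectedSpace N] [ChartedSpace (EuclideanSpace ℝ (Fin 4)) N]
      [IsManifold (𝓡 4) ∞ N] (μ : HomologicalOrientation ℤ N 4),
      kroneckerPairing ℤ ℤ N 4 (degCast ℤ (by norm_num : 4 * 1 = 4) (tangentPontryaginClass (𝓡 4) N 1))
        μ.fundamentalClass = 3 * μ.signature)
    (hc₂ : ∀ (N : Type) [TopologicalSpace N] [T2Space N] [SecondCountableTopology N]
      [CompactSpace N] [ConnectedSpace N] [ChartedSpace (EuclideanSpace ℝ (Fin 4)) N]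
      [IsManifold (𝓡 4) ∞ N] (J : AlmostComplexStructure (𝓡 4) ∞ N)
      (μ : HomologicalOrientation ℤ N 4), μ.IsComplexOrientationOf J →
      kroneckerPairing ℤ ℤ N 4 (degCast ℤ (by norm_num : 2 * 2 = 4) (J.chernClass 2))
        μ.fundamentalClass = relEuler ℤ ℤ N ∅) :
    hirzebruch_firstChernClass_sq_eq_almostComplex_four := by
  intro N _ _ _ _ _ _ _ J μ hμ
  have h1 := three_mul_signature_eq_of_signatureTheorem hsig N J μ
  have h2 := hc₂ N J μ hμ
  rw [h2] at h1
  linarith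

/-- **`⟨c₁² - 2 c₂, [N]_μ⟩ = ⟨p₁, [N]_μ⟩` for a closed almost complex `4`-manifold and ANY
`ℤ`-orientation `μ`** — the numerical form of `p₁ = c₁² - 2c₂` (Hirzebruch Thm. 4.5.1;
Milnor–Stasheff Cor. 15.5), i.e. hypothesis (B2) `chernNumber_eq_pontryaginNumber` of the
`SymplecticChernPackage` crux sketches, proved. [cite: Hirzebruch1966, Thm. 4.5.1 (p. 66)] -/
theorem firstChernClass_sq_sub_two_mul_chernNumber_eq_pontryaginNumber
    (N : Type) [TopologicalSpace N] [T2Space N] [CompactSpace N]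
    [ChartedSpace (EuclideanSpace ℝ (Fin 4)) N] [IsManifold (𝓡 4) ∞ N]
    (J : AlmostComplexStructure (𝓡 4) ∞ N) (μ : HomologicalOrientation ℤ N 4) :
    cupPairing μ two_add_two_eq_four J.firstChernClass J.firstChernClass -
        2 * kroneckerPairing ℤ ℤ N 4 (degCast ℤ (by norm_num : 2 * 2 = 4) (J.chernClass 2)) μ.fundamentalClass =
      kroneckerPairing ℤ ℤ N 4 (degCast ℤ (by norm_num : 4 * 1 = 4) (tangentPontryaginClass (𝓡 4) N 1))
        μ.fundamentalClass := by
  rw [J.tangentPontryaginClass_one_eq, map_sub, LinearMap.sub_apply, cupPairing_apply,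
    LinearMap.map_smul_of_tower, LinearMap.smul_apply, smul_eq_mul]

end Literature.Geometry.Symplectic
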